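import Literature.NumberTheory.Weil1964.ArchWeilDatumConj
import Literature.Analysis.SegalBargmann.SchwartzFourierUnitary
import Literature.Analysis.SegalBargmann.SchwartzMetaplecticGenerators
import Literature.RepresentationTheory.HeisenbergGroup.SymplecticMatrixTransport
import Literature.NumberTheory.Automorphic.UnitaryGroupSymplecticRationalPoints
import HarnessLib

/-!
# The metaplectic extension of `Sp(2n, ℝ)` in the Schwartz model: `1 → S¹ → Mp^𝓢(W) → Sp(W) → 1`

[cite: Folland1989, §4.1 Prop. (4.10); §4.2 (4.23)–(4.27); Prop. (4.39)]
[cite: MoeglinVignerasWaldspurger1987, Chap. 2 II.1 (A)–(B)]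

Topic `NumberTheory/Weil1964`; namespace `Literature.NumberTheory.Weil1964`.  Definitions and proved lemmas only:
**no named facts, no records, 0 proof holes, 0 cited hypotheses** (the `[cite: …]` tags are provenance of kernel
theorems; nothing enters as a hypothesis).

Weil-1's intertwining group `MpPsi (schwartzSchrodinger σ)` (T6 `LocalWeilProjective`, MVW Chap. 2 II.1 (B), on the
Schwartz model `SchwartzHeisenbergModel`) consists of ALL pairs `(g, M)` with `M` a LINEAR automorphism of `𝓢(ℝ^σ)`
implementing `g ∈ Sp(W)`, `W = ℝ^σ × ℝ^σ`.  Folland's `μ(𝒜)` [(4.23)] is more: a UNITARY operator of `L²(ℝ^σ)` mapping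
`𝓢` isomorphically onto itself [Prop. (4.27)].  This file cuts out the corresponding subgroup

  `MpS σ = {(g, S) : S` a topological automorphism of `𝓢(ℝ^σ)` implementing `g`, AND the restriction of a unitary of `L²}`

of `Sp(W) × Aut_top(𝓢)` and proves that the projection `MpS σ → Sp(W)` is ONTO with fibres the unimodular scalars:

* `Sp.eq_top_of_levi_unipotent_weyl_mem` — Folland Prop. (4.10) for weil-1's `Sp(W, dotPairing σ)`: a subgroup containing
  the Levi elements `m(a, d)`, the unipotents `n(b)` of the Siegel parabolic and one Weyl element `(p, q) ↦ (-q, p)` is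
  everything (Mathlib's generation over a local ring, tree `SymplecticSiegelGeneration`, transported by
  `SymplecticMatrixTransport` / `SpTransport.range_transportSp_eq_top`);
* `MpS.proj_surjective`, `exists_implementerS` — EVERY `g ∈ Sp(W)` carries a continuous, unitarily liftable implementer
  on `𝓢(ℝ^σ)` [(4.23) with Prop. (4.27)]: the generators are implemented by tree `leviEquiv` [(4.24)], `chirpEquiv`
  [(4.25)] and `unitaryEquivPi` of `i·1 ∈ U(σ)` (the Fourier transform, (4.26) / Prop. (4.39)), and implementers compose;
* `existsImplementer_schwartzSchrodinger` / `MpPsi_proj_surjective` — the same in T6's currency `ExistsImplementer`;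
* `MpS.exists_unitSmul_of_proj_eq_one` — the fibre over `1` consists of unimodular scalars ("determined up to a phase
  factor", Schur; tree T14 `implements_eq_unitSmul_of_liftsTo`), `MpS.unitScalar` puts every such scalar there, and `MpS.proj_eq_one_iff` is the exactness statement.

No choice of phases (the `±1` refinement announced after (4.23) / the Rao–Maslov cocycle) is made here: this is the
`S¹`-extension, which is all that `IsArchWeilDatum` (w1)/(w2′) quantify over.
-/

noncomputable section

open MeasureTheory Complex SchwartzMap

namespace Literature.NumberTheory.Weil1964

open Literature.Analysis.SegalBargmann Literature.RepresentationTheory.HeisenbergGroup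

variable {σ : Type*} [Fintype σ] [DecidableEq σ]

local notation "L2R" σ => Lp ℂ 2 (volume : Measure (σ → ℝ))
local notation "SR" σ => SchwartzMap (σ → ℝ) ℂ
local notation "PV" σ => (σ → ℝ) × (σ → ℝ)
local notation "SpR" σ => symplecticGroup (polar (dotPairing σ))

/-- Notation (NOT a definition): `HasUnitaryLift[σ] A` abbreviates the (w2′) clause shape of
`IsArchWeilDatum.exists_lift` — `A : 𝓢 →ₗ 𝓢` is the restriction of SOME unitary operator of `L²(ℝ^σ)`. -/
local notation "HasUnitaryLift[" σ "]" A:max =>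
  ∃ U : Lp ℂ 2 (volume : Measure (σ → ℝ)) ≃ₗᵢ[ℂ] Lp ℂ 2 (volume : Measure (σ → ℝ)),
    LiftsTo A ((LinearIsometryEquiv.toContinuousLinearEquiv U :
        Lp ℂ 2 (volume : Measure (σ → ℝ)) ≃L[ℂ] Lp ℂ 2 (volume : Measure (σ → ℝ))) :
      Lp ℂ 2 (volume : Measure (σ → ℝ)) →L[ℂ] Lp ℂ 2 (volume : Measure (σ → ℝ)))

/-! ## 1. Generation of `Sp(W, dotPairing σ)` by Levi elements, Siegel unipotents and one Weyl element -/

section Generation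

variable (σ) in
/-- Weil-1's self-pairing `dotPairing σ` is the bilinear form of the identity matrix. [folklore] -/
theorem toLinearMap₂'_one_eq_dotPairing : Matrix.toLinearMap₂' ℝ (1 : Matrix σ σ ℝ) = dotPairing σ := by
  refine LinearMap.ext fun x => LinearMap.ext fun y => ?_
  rw [Matrix.toLinearMap₂'_apply', Matrix.one_mulVec, dotPairing_apply]

/-- Generation, auxiliary form over a variable pairing `β` SUBSTITUTED by the matrix form of `1` (so that the transport
lemmas of `SymplecticMatrixTransport` apply literally). [cite: Folland1989, §4.1 Prop. (4.10)] -/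
theorem Sp.eq_top_of_levi_unipotent_weyl_mem_aux (β : (σ → ℝ) →ₗ[ℝ] (σ → ℝ) →ₗ[ℝ] ℝ)
    (hβ : β = Matrix.toLinearMap₂' ℝ (1 : Matrix σ σ ℝ)) {L : Subgroup (symplecticGroup (polar β))}
    (hm : ∀ (a d : (σ → ℝ) ≃ₗ[ℝ] (σ → ℝ)) (had : ∀ x y, β (a x) (d y) = β x y), leviSp β a d had ∈ L)
    (hv : ∀ (b : (σ → ℝ) →ₗ[ℝ] (σ → ℝ)) (hb : ∀ x x', β x (b x') = β x' (b x)), unipotentSp β b hb ∈ L)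
    (hw : ∃ w ∈ L, ∀ p q : σ → ℝ, (w.1 : (PV σ) ≃ₗ[ℝ] PV σ) (p, q) = (-q, p)) : L = ⊤ := by
  subst hβ
  have h1 : IsUnit (1 : Matrix σ σ ℝ).det := by rw [Matrix.det_one]; exact isUnit_one
  obtain ⟨w, hwL, hw⟩ := hw
  have hwEq : weylSp (Matrix.toLinearMap₂' ℝ (1 : Matrix σ σ ℝ)) (SymplecticMatrix.weylGamma 1 h1)
      (SymplecticMatrix.gramEquiv 1 h1).symm (SymplecticMatrix.weylGamma_compat 1 h1) = w := by
    apply Subtype.ext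
    refine LinearEquiv.ext fun v => ?_
    obtain ⟨p, q⟩ := v
    rw [coe_weylSp, weylσ_apply, SymplecticMatrix.weylGamma_apply, SymplecticMatrix.gramEquiv_symm_apply, hw p q,
      Matrix.one_mulVec, inv_one, Matrix.one_mulVec]
  have hle := SymplecticMatrix.range_transportSp_mapHom_le (RingHom.id ℝ) (1 : Matrix σ σ ℝ) h1 (L := L)
    (fun a => hm _ _ _) (fun c hc => hv _ _) (hwEq ▸ hwL)
  rw [eq_top_iff]
  intro g _
  obtain ⟨A, hA⟩ := MonoidHom.range_eq_top.1
    (Literature.NumberTheory.Automorphic.UnitaryGroup.SpTransport.range_transportSp_eq_top (1 : Matrix σ σ ℝ) h1) g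
  have hmap : SymplecticMatrix.mapHom (RingHom.id ℝ) A = A :=
    Subtype.ext (by rw [SymplecticMatrix.coe_mapHom]; exact Matrix.map_id _)
  refine hle ⟨A, ?_⟩
  rw [MonoidHom.comp_apply, hmap, hA]

/-- **Folland (4.10) for weil-1's `Sp(W)`, `W = ℝ^σ × ℝ^σ` with the dot pairing.** A subgroup of `Sp(W)` containing every
Levi element `m(a, d)` (`a x · d y = x · y`), every unipotent `n(b)` of the Siegel parabolic (`b` symmetric) and an
element acting by `(p, q) ↦ (-q, p)` is all of `Sp(W)`. [cite: Folland1989, §4.1 Prop. (4.10)] -/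
theorem Sp.eq_top_of_levi_unipotent_weyl_mem {L : Subgroup (SpR σ)}
    (hm : ∀ (a d : (σ → ℝ) ≃ₗ[ℝ] (σ → ℝ)) (had : ∀ x y, dotPairing σ (a x) (d y) = dotPairing σ x y),
      leviSp (dotPairing σ) a d had ∈ L)
    (hv : ∀ (b : (σ → ℝ) →ₗ[ℝ] (σ → ℝ)) (hb : ∀ x x', dotPairing σ x (b x') = dotPairing σ x' (b x)),
      unipotentSp (dotPairing σ) b hb ∈ L)
    (hw : ∃ w ∈ L, ∀ p q : σ → ℝ, (w.1 : (PV σ) ≃ₗ[ℝ] PV σ) (p, q) = (-q, p)) : L = ⊤ :=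
  Sp.eq_top_of_levi_unipotent_weyl_mem_aux (dotPairing σ) (toLinearMap₂'_one_eq_dotPairing σ).symm hm hv hw

end Generation

/-! ## 2. The metaplectic group of the Schwartz model -/

variable (σ) in
/-- **The metaplectic group of the Schwartz model** `Mp^𝓢(W)`: pairs `(g, S)` with `S` a topological automorphism of
`𝓢(ℝ^σ)` implementing `g` (`(g, S) ∈ MpPsi`) that is the restriction of a unitary operator of `L²(ℝ^σ)`.
[cite: Folland1989, §4.2 (4.23), Prop. (4.27); MoeglinVignerasWaldspurger1987, Chap. 2 II.1 (B)] -/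
def MpS : Subgroup ((SpR σ) × ((SR σ) ≃L[ℂ] SR σ)) where
  carrier := {x | (x.1, x.2.toLinearEquiv) ∈ MpPsi (schwartzSchrodinger σ) ∧
    HasUnitaryLift[σ] ((x.2 : (SR σ) →L[ℂ] SR σ) : (SR σ) →ₗ[ℂ] SR σ)}
  one_mem' := by
    refine ⟨(MpPsi (schwartzSchrodinger σ)).one_mem, LinearIsometryEquiv.refl ℂ _, fun f => rfl⟩
  mul_mem' := by
    rintro x y ⟨hx, U, hU⟩ ⟨hy, V, hV⟩
    refine ⟨(MpPsi (schwartzSchrodinger σ)).mul_mem hx hy, V.trans U, fun f => ?_⟩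
    show toL2 (x.2 (y.2 f)) = U (V (toL2 f))
    have h1 : toL2 (x.2 (y.2 f)) = U (toL2 (y.2 f)) := hU (y.2 f)
    have h2 : toL2 (y.2 f) = V (toL2 f) := hV f
    rw [h1, h2]
  inv_mem' := by
    rintro x ⟨hx, U, hU⟩
    refine ⟨(MpPsi (schwartzSchrodinger σ)).inv_mem hx, U.symm, fun f => ?_⟩
    show toL2 (x.2.symm f) = U.symm (toL2 f)
    have h1 : toL2 (x.2 (x.2.symm f)) = U (toL2 (x.2.symm f)) := hU (x.2.symm f)
    rw [ContinuousLinearEquiv.apply_symm_apply] at h1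
    rw [h1, LinearIsometryEquiv.symm_apply_apply]

namespace MpS

omit [DecidableEq σ] in
/-- Membership. [cite: Folland1989, §4.2 (4.23), Prop. (4.27)] -/
theorem mem_iff (x : (SpR σ) × ((SR σ) ≃L[ℂ] SR σ)) :
    x ∈ MpS σ ↔ (x.1, x.2.toLinearEquiv) ∈ MpPsi (schwartzSchrodinger σ) ∧
      HasUnitaryLift[σ] ((x.2 : (SR σ) →L[ℂ] SR σ) : (SR σ) →ₗ[ℂ] SR σ) :=
  Iff.rfl

omit [DecidableEq σ] in
/-- Membership through the dictionary: covariance `S ρ(p,q) = ρ(g(p,q)) S` on `𝓢(ℝ^σ)` plus a unitary lift.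
[cite: Folland1989, §4.2 (4.23)] -/
theorem mem_iff_covariant (x : (SpR σ) × ((SR σ) ≃L[ℂ] SR σ)) :
    x ∈ MpS σ ↔ (∀ (p q : σ → ℝ) (f : SR σ), x.2 (rhoS p q f) = rhoS (x.1.1 (p, q)).1 (x.1.1 (p, q)).2 (x.2 f)) ∧
      HasUnitaryLift[σ] ((x.2 : (SR σ) →L[ℂ] SR σ) : (SR σ) →ₗ[ℂ] SR σ) := by
  rw [mem_iff, mem_MpPsi_iff]
  rfl

/-- The projection `(g, S) ↦ g`. [cite: Folland1989, §4.2 (4.23); MoeglinVignerasWaldspurger1987, Chap. 2 II.1 (B)] -/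
def proj : MpS σ →* SpR σ := (MonoidHom.fst _ _).comp (MpS σ).subtype

omit [DecidableEq σ] in
/-- Unfolding. [folklore] -/
@[simp] theorem proj_apply (x : MpS σ) : proj x = x.1.1 := rfl

/-- The inclusion `Mp^𝓢(W) →* MpPsi (schwartzSchrodinger σ)` (forget topology and the lift). [folklore] -/
def toMpPsi : MpS σ →* MpPsi (schwartzSchrodinger σ) where
  toFun x := ⟨(x.1.1, x.1.2.toLinearEquiv), x.2.1⟩
  map_one' := rfl
  map_mul' _ _ := rfl

omit [DecidableEq σ] in
/-- Unfolding. [folklore] -/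
@[simp] theorem coe_toMpPsi (x : MpS σ) :
    ((toMpPsi x : MpPsi (schwartzSchrodinger σ)) : (SpR σ) × ((SR σ) ≃ₗ[ℂ] SR σ)) = (x.1.1, x.1.2.toLinearEquiv) := rfl

omit [DecidableEq σ] in
/-- The inclusion is injective (a continuous operator is determined by its underlying linear map). [folklore] -/
theorem toMpPsi_injective : Function.Injective (toMpPsi (σ := σ)) := by
  intro x y h
  have h' := congrArg Subtype.val h
  simp only [coe_toMpPsi, Prod.mk.injEq] at h'
  exact Subtype.ext (Prod.ext h'.1 (ContinuousLinearEquiv.ext (funext fun f => LinearEquiv.congr_fun h'.2 f)))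

omit [DecidableEq σ] in
/-- `MpPsi.proj ∘ toMpPsi = proj`. [folklore] -/
theorem proj_toMpPsi (x : MpS σ) : MpPsi.proj (schwartzSchrodinger σ) (toMpPsi x) = proj x := rfl

/-! ### Generators as elements of `Mp^𝓢(W)` -/

/-- The Levi element `(m(a, d), f ↦ f ∘ a⁻¹ · |det a|^{-1/2})`. [cite: Folland1989, §4.2 (4.24)] -/
def levi (a d : (σ → ℝ) ≃ₗ[ℝ] (σ → ℝ)) (had : ∀ x y, dotPairing σ (a x) (d y) = dotPairing σ x y) : MpS σ :=
  ⟨(leviSp (dotPairing σ) a d had, leviEquiv a), levi_mem_MpPsi had, leviL2 a, liftsTo_leviS a⟩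

/-- The Siegel unipotent `(n(b), chirp multiplication)`. [cite: Folland1989, §4.2 (4.25)] -/
def unip (b : (σ → ℝ) →ₗ[ℝ] (σ → ℝ)) (hb : ∀ x x', dotPairing σ x (b x') = dotPairing σ x' (b x)) : MpS σ :=
  ⟨(unipotentSp (dotPairing σ) b hb, chirpEquiv b), chirp_mem_MpPsi hb, chirpL2 b, liftsTo_chirpS b⟩

/-- The compact elements `(realify u, μ₀(u))`, `u ∈ U(σ)` — in particular the Fourier transform over `u = i·1`.
[cite: Folland1989, §4.2 (4.26), Prop. (4.39)] -/
def unitary (u : Matrix.unitaryGroup σ ℂ) : MpS σ :=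
  ⟨(realifySp σ u, unitaryEquivPi u), implements_unitaryEquivPi u, schrodingerU u, liftsTo_unitaryEquivPi u⟩

omit [DecidableEq σ] in
/-- `proj (levi a d) = m(a, d)`. [folklore] -/
@[simp] theorem proj_levi (a d : (σ → ℝ) ≃ₗ[ℝ] (σ → ℝ)) (had : ∀ x y, dotPairing σ (a x) (d y) = dotPairing σ x y) :
    proj (levi a d had) = leviSp (dotPairing σ) a d had := rfl

omit [DecidableEq σ] in
/-- `proj (unip b) = n(b)`. [folklore] -/
@[simp] theorem proj_unip (b : (σ → ℝ) →ₗ[ℝ] (σ → ℝ)) (hb : ∀ x x', dotPairing σ x (b x') = dotPairing σ x' (b x)) :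
    proj (unip b hb) = unipotentSp (dotPairing σ) b hb := rfl

/-- `proj (unitary u) = realify u`. [folklore] -/
@[simp] theorem proj_unitary (u : Matrix.unitaryGroup σ ℂ) : proj (unitary u) = realifySp σ u := rfl

/-- `u = i·1 ∈ U(σ)` realifies to the Weyl element `(p, q) ↦ (-q, p)`. [cite: Folland1989, §4.2 (4.26)] -/
theorem coe_proj_unitary_I (p q : σ → ℝ) :
    ((proj (unitary (diagHom (fun _ : σ => Circle.exp (Real.pi / 2))))).1 : (PV σ) ≃ₗ[ℝ] PV σ) (p, q) = (-q, p) := by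
  rw [proj_unitary, coe_realifySp]
  exact realify_diagHom_I p q

/-! ## 3. Exactness on the right: every `g ∈ Sp(W)` is implemented -/

/-- **`Mp^𝓢(W) → Sp(W)` is onto.** [cite: Folland1989, §4.1 Prop. (4.10), §4.2 (4.23)–(4.27)] -/
theorem range_proj_eq_top : (proj (σ := σ)).range = ⊤ :=
  Sp.eq_top_of_levi_unipotent_weyl_mem (fun a d had => ⟨levi a d had, rfl⟩) (fun b hb => ⟨unip b hb, rfl⟩)
    ⟨_, ⟨unitary (diagHom fun _ : σ => Circle.exp (Real.pi / 2)), rfl⟩, coe_proj_unitary_I⟩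

/-- **`Mp^𝓢(W) → Sp(W)` is onto**, as surjectivity. [cite: Folland1989, §4.1 Prop. (4.10), §4.2 (4.23)–(4.27)] -/
theorem proj_surjective : Function.Surjective (proj (σ := σ)) :=
  MonoidHom.range_eq_top.1 range_proj_eq_top

end MpS

/-- **Existence of implementers on `𝓢(ℝ^σ)`** [Folland (4.23) with Prop. (4.27)]: for every `g ∈ Sp(W)` there is a
topological automorphism `S` of `𝓢(ℝ^σ)` with `S ρ(p,q) S⁻¹ = ρ(g(p,q))`, which is the restriction of a unitary operator of
`L²(ℝ^σ)`. [cite: Folland1989, §4.2 (4.23), Prop. (4.27)] -/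
theorem exists_implementerS (g : SpR σ) :
    ∃ S : (SR σ) ≃L[ℂ] SR σ, (g, S.toLinearEquiv) ∈ MpPsi (schwartzSchrodinger σ) ∧
      HasUnitaryLift[σ] ((S : (SR σ) →L[ℂ] SR σ) : (SR σ) →ₗ[ℂ] SR σ) := by
  obtain ⟨x, hx⟩ := MpS.proj_surjective g
  refine ⟨x.1.2, ?_, x.2.2⟩
  rw [← hx]
  exact x.2.1

/-- Covariance form of `exists_implementerS`. [cite: Folland1989, §4.2 (4.23), Prop. (4.27)] -/
theorem exists_implementerS_covariant (g : SpR σ) :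
    ∃ S : (SR σ) ≃L[ℂ] SR σ, (∀ (p q : σ → ℝ) (f : SR σ), S (rhoS p q f) = rhoS (g.1 (p, q)).1 (g.1 (p, q)).2 (S f)) ∧
      HasUnitaryLift[σ] ((S : (SR σ) →L[ℂ] SR σ) : (SR σ) →ₗ[ℂ] SR σ) := by
  obtain ⟨S, hS, hU⟩ := exists_implementerS g
  exact ⟨S, (mem_MpPsi_iff (σ := σ) g S.toLinearEquiv).1 hS, hU⟩

/-- **Implementers exist** for the Schwartz model, in T6's currency `ExistsImplementer` (MVW II.1 (B): the hypothesis
under which `MpPsi.proj` is onto). [cite: Folland1989, §4.2 (4.23), Prop. (4.27); MoeglinVignerasWaldspurger1987, Chap. 2 II.1 (B)] -/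
theorem existsImplementer_schwartzSchrodinger : ExistsImplementer (schwartzSchrodinger σ) := fun g => by
  obtain ⟨S, hS, -⟩ := exists_implementerS g
  exact ⟨S.toLinearEquiv, (mem_MpPsi _ _).1 hS⟩

/-- **The whole intertwining group lies over all of `Sp(W)`** too: `MpPsi.proj` is onto. [cite: MoeglinVignerasWaldspurger1987, Chap. 2 II.1 (B)] -/
theorem MpPsi_proj_surjective : Function.Surjective (MpPsi.proj (schwartzSchrodinger σ)) :=
  MpPsi.proj_surjective _ existsImplementer_schwartzSchrodinger

/-! ## 4. Exactness in the middle: the fibre over `1` is the circle -/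

namespace MpS

/-- **"determined up to a phase factor"**: an element of `Mp^𝓢(W)` over `g = 1` is a unimodular scalar.
[cite: Folland1989, §4.2 (4.23) ("determined up to a phase factor"); MoeglinVignerasWaldspurger1987, Chap. 2 II.1 (A)] -/
theorem exists_unitSmul_of_proj_eq_one {x : MpS σ} (hx : proj x = 1) :
    ∃ c : ℂ, ‖c‖ = 1 ∧ ∀ f : SR σ, x.1.2 f = c • f := by
  obtain ⟨U, hU⟩ := x.2.2
  have h1 : Implements (schwartzSchrodinger σ) (ofSymplectic _ (1 : SpR σ)) (1 : (SR σ) ≃ₗ[ℂ] SR σ) :=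
    (MpPsi (schwartzSchrodinger σ)).one_mem
  have hx' : Implements (schwartzSchrodinger σ) (ofSymplectic _ (1 : SpR σ)) x.1.2.toLinearEquiv := by
    have h := x.2.1
    rw [mem_MpPsi] at h
    simpa only [← proj_apply, hx] using h
  obtain ⟨c, hc, hcf⟩ := implements_eq_unitSmul_of_liftsTo (σ := σ) (U := LinearIsometryEquiv.refl ℂ _) (U' := U) h1 hx'
    (fun f => rfl) hU
  exact ⟨c, hc, fun f => hcf f⟩

/-- Two elements of `Mp^𝓢(W)` over the same `g` differ by a unimodular scalar. [cite: Folland1989, §4.2 (4.23); MoeglinVignerasWaldspurger1987, Chap. 2 II.1 (A)] -/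
theorem exists_unitSmul_of_proj_eq {x y : MpS σ} (h : proj x = proj y) :
    ∃ c : ℂ, ‖c‖ = 1 ∧ ∀ f : SR σ, y.1.2 f = c • x.1.2 f := by
  have hk : proj (x⁻¹ * y) = 1 := by rw [map_mul, map_inv, h, inv_mul_cancel]
  obtain ⟨c, hc, hcf⟩ := exists_unitSmul_of_proj_eq_one hk
  refine ⟨c, hc, fun f => ?_⟩
  have h1 : x.1.2.symm (y.1.2 f) = c • f := hcf f
  rw [← x.1.2.apply_symm_apply (y.1.2 f), h1, map_smul]

/-- Multiplication by a non-zero scalar as a topological automorphism of `𝓢(ℝ^σ)`. [folklore] -/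
def smulEquivS (c : ℂ) (hc : c ≠ 0) : (SR σ) ≃L[ℂ] SR σ :=
  ContinuousLinearEquiv.equivOfInverse (c • ContinuousLinearMap.id ℂ (SR σ)) (c⁻¹ • ContinuousLinearMap.id ℂ (SR σ))
    (fun f => by
      show c⁻¹ • (c • f) = f
      rw [smul_smul, inv_mul_cancel₀ hc, one_smul])
    (fun f => by
      show c • (c⁻¹ • f) = f
      rw [smul_smul, mul_inv_cancel₀ hc, one_smul])

omit [DecidableEq σ] in
/-- Unfolding. [folklore] -/
@[simp] theorem smulEquivS_apply (c : ℂ) (hc : c ≠ 0) (f : SR σ) : smulEquivS c hc f = c • f := rfl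

/-- Multiplication by a unimodular scalar as a linear isometry of `L²(ℝ^σ)`. [folklore] -/
def unitSmulL2 (c : ℂ) (hc : ‖c‖ = 1) : (L2R σ) ≃ₗᵢ[ℂ] L2R σ where
  toLinearEquiv := LinearEquiv.smulOfNeZero ℂ (L2R σ) c (by rintro rfl; rw [norm_zero] at hc; exact zero_ne_one hc)
  norm_map' x := by
    show ‖c • x‖ = ‖x‖
    rw [norm_smul, hc, one_mul]

/-- **The unimodular scalars lie in the fibre over `1`**: `(1, c • id) ∈ Mp^𝓢(W)` for `‖c‖ = 1` (lift `c • id` of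
`L²`). Together with `exists_unitSmul_of_proj_eq_one`: the fibre of `proj` over `1` is exactly the circle.
[cite: Folland1989, §4.2 (4.23); MoeglinVignerasWaldspurger1987, Chap. 2 II.1 (B)] -/
def unitScalar (c : ℂ) (hc : ‖c‖ = 1) : MpS σ :=
  ⟨(1, smulEquivS c (by rintro rfl; rw [norm_zero] at hc; exact zero_ne_one hc)), by
    refine ⟨(mem_MpPsi_iff (σ := σ) _ _).2 fun p q f => ?_, unitSmulL2 c hc, fun f => ?_⟩
    · show c • rhoS p q f = rhoS p q (c • f)
      rw [map_smul]
    · show toL2 (c • f) = c • toL2 f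
      rw [map_smul]⟩

omit [DecidableEq σ] in
/-- `proj (unitScalar c) = 1`. [folklore] -/
@[simp] theorem proj_unitScalar (c : ℂ) (hc : ‖c‖ = 1) : proj (unitScalar (σ := σ) c hc) = 1 := rfl

omit [DecidableEq σ] in
/-- `unitScalar c` acts by `c`. [folklore] -/
@[simp] theorem unitScalar_apply (c : ℂ) (hc : ‖c‖ = 1) (f : SR σ) : (unitScalar (σ := σ) c hc).1.2 f = c • f := rfl

/-- **Exactness in the middle**: `x ∈ Mp^𝓢(W)` lies over `1` iff it is a unimodular scalar.
[cite: Folland1989, §4.2 (4.23); MoeglinVignerasWaldspurger1987, Chap. 2 II.1 (A)–(B)] -/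
theorem proj_eq_one_iff (x : MpS σ) : proj x = 1 ↔ ∃ (c : ℂ) (hc : ‖c‖ = 1), x = unitScalar c hc := by
  refine ⟨fun hx => ?_, ?_⟩
  · obtain ⟨c, hc, hcf⟩ := exists_unitSmul_of_proj_eq_one hx
    refine ⟨c, hc, Subtype.ext (Prod.ext ?_ (ContinuousLinearEquiv.ext (funext fun f => ?_)))⟩
    · exact hx
    · rw [hcf f]
      rfl
  · rintro ⟨c, hc, rfl⟩
    rfl

end MpS

end Literature.NumberTheory.Weil1964
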